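import Summits.AtomisticToContinuum.BoseEinsteinCondensation.Theorems.InfraredMinimumUncertainty.Negative.CoherenceBounds
import Literature.MathematicalPhysics.QuantumManyBody.PeriodicBoseGasEq317Bdd

/-!
# Route `BECConjugateDomination`, crux `InfraredMinimumUncertainty` (stmt-AtomisticToContinuum-11784),
# line `fisher-gaussian-density-mode`: the registered stub `stub_coherenceRegular` (lead reshape r1)

Supports (does not close) stmt-AtomisticToContinuum-11784. For a pointwise non-vanishing periodic `C¹`
state `Ψ` of `N = n + 1` bosons on the torus of side `L > 0`, the translation-averaged one-body
coherence `g(r) = ∫_cell dx ∫_{cell^n} dY |Ψ(x+r,Y)| |Ψ(x,Y)|` (`coherence n L Ψ r` of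
`Theorems/BECConjugateDominationDefs.lean`, definitionally the integral of the stub signature) is

* continuous (`continuous_coherence`: dominated convergence twice, with the global bound of the
  continuous periodic `Ψ`, `PeriodicTrialState.exists_norm_le`, on the finite-measure cells);
* strictly positive (`coherence_pos`: `|Ψ|` is bounded below by a positive constant — its minimum over
  the compact closed ball containing the fundamental cell, where every value of `|Ψ|` is taken,
  `exists_mem_cellN_norm_eq` — and the cells have positive measure);
* `≤ 1` and `= 1` at `r = 0` (`coherence_le_one`, `coherence_zero` of
  `Theorems/InfraredMinimumUncertainty/Negative/CoherenceBounds.lean`, reused, not restated);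
* even (`coherence_neg`: the torus shift `X ↦ X + (r, 0, …, 0)` of the fundamental cell,
  `lintegral_cellN_comp_add`, after splitting particle `0` off, `setLIntegral_cellN_succ_left`);
* `Lℤ³`-periodic (`coherence_add_single`: pointwise from `Ψ.periodic` in particle `0`).

The registered stub is then assembled verbatim (`stub_coherenceRegular`, namespace
`…Theorems.BECConjugateDomination`, so that the skeleton can cite it without a name clash).
-/

noncomputable section

open Literature.MathematicalPhysics.QuantumManyBody.BoseGas
open MeasureTheory Filter Set
open scoped ENNReal NNReal ComplexConjugate BigOperators

namespace Summit.AtomisticToContinuum.BoseEinsteinCondensation.Theorems.BECConjugateDomination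

open Summit.AtomisticToContinuum.BoseEinsteinCondensation.Cruxes.InfraredMinimumUncertainty.FisherGaussianDensityMode
open Summit.AtomisticToContinuum.BoseEinsteinCondensation.Theorems.InfraredMinimumUncertainty.Negative
  (coherence_eq_toReal coherence_le_one coherence_zero)

variable {n N : ℕ} {L : ℝ}

/-! ## Values of a periodic state are taken on the cell; global two-sided bounds -/

/-- Every value of `|Ψ|` is taken on the fundamental cell `[0,L)^{3N}` (reduction modulo the period
lattice `(Lℤ³)^N` by `ZSpan.fract`, invariance of `|Ψ|` under the lattice). -/
theorem exists_mem_cellN_norm_eq (hL : 0 < L) (Ψ : PeriodicTrialState N L) (X : Config N) :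
    ∃ X' ∈ cellN N L, ‖Ψ.ψ X'‖ = ‖Ψ.ψ X‖ := by
  -- adapted from `PeriodicTrialState.exists_norm_le` (PeriodicBoseGasEq317Bdd): the lattice basis of
  -- `(Lℤ³)^N`, abstracted together with its two properties (fundamental domain = cell, invariance)
  obtain ⟨b, hbd, hbper⟩ : ∃ b : Module.Basis (Σ _ : Fin N, Fin 3) ℝ (Config N),
      ZSpan.fundamentalDomain b = cellN N L ∧
        ∀ (g : (Submodule.span ℤ (Set.range b)).toAddSubgroup) (X : Config N),
          (fun X => (‖Ψ.ψ X‖₊ : ℝ≥0∞)) (g +ᵥ X) = (fun X => (‖Ψ.ψ X‖₊ : ℝ≥0∞)) X :=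
    ⟨_, fundamentalDomain_latticeBasisN hL,
      periodic_zspan hL (G := fun X => (‖Ψ.ψ X‖₊ : ℝ≥0∞)) fun X i k => by simp only [Ψ.periodic]⟩
  refine ⟨ZSpan.fract b X, ?_, ?_⟩
  · rw [← hbd]
    exact ZSpan.fract_mem_fundamentalDomain b X
  · have hper := hbper ⟨(ZSpan.floor b X : Config N), (ZSpan.floor b X).2⟩ (ZSpan.fract b X)
    rw [AddSubgroup.vadd_def, vadd_eq_add] at hper
    have hX : (ZSpan.floor b X : Config N) + ZSpan.fract b X = X := by
      rw [ZSpan.fract_apply]; abel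
    simp only [hX, ENNReal.coe_inj] at hper
    have h := congrArg (fun t : ℝ≥0 => (t : ℝ)) hper
    simp only [coe_nnnorm] at h
    exact h.symm

/-- A pointwise non-vanishing periodic trial state is bounded below by a positive constant (the
minimum of the continuous `|Ψ| > 0` over the compact closed ball of radius `2L`, which contains the
fundamental cell, where every value of `|Ψ|` is taken). -/
theorem exists_pos_forall_le_norm (hL : 0 < L) (Ψ : PeriodicTrialState N L)
    (hpos : ∀ X, Ψ.ψ X ≠ 0) : ∃ m : ℝ, 0 < m ∧ ∀ X, m ≤ ‖Ψ.ψ X‖ := by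
  have hK : IsCompact (Metric.closedBall (0 : Config N) (2 * L)) := isCompact_closedBall _ _
  have hne : (Metric.closedBall (0 : Config N) (2 * L)).Nonempty :=
    ⟨0, Metric.mem_closedBall_self (by linarith)⟩
  obtain ⟨X₀, -, hX₀⟩ := hK.exists_isMinOn hne Ψ.contDiff.continuous.norm.continuousOn
  refine ⟨‖Ψ.ψ X₀‖, norm_pos_iff.mpr (hpos X₀), fun X => ?_⟩
  obtain ⟨X', hX', hXX'⟩ := exists_mem_cellN_norm_eq hL Ψ X
  rw [← hXX']
  refine (isMinOn_iff.mp hX₀) X' (Metric.mem_closedBall.2 ?_)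
  rw [dist_zero_right]
  exact norm_le_of_mem_cellN hL hX'

/-! ## The five properties of the coherence -/

/-- **`g` is continuous**: dominated convergence in the parameter `r`, twice (inner integral jointly in
`(r, x)`, then the outer integral), with the constant bound `sup |Ψ|²` on the finite-measure cells. -/
theorem continuous_coherence (hL : 0 < L) (Ψ : PeriodicTrialState (n + 1) L) :
    Continuous (coherence n L Ψ) := by
  obtain ⟨M, hM⟩ := Ψ.exists_norm_le hL
  have hc : Continuous Ψ.ψ := Ψ.contDiff.continuous
  have hM0 : 0 ≤ M := (norm_nonneg _).trans (hM 0)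
  have hvc : volume (cell L) ≠ ⊤ := by
    rw [volume_cell]; exact ENNReal.pow_ne_top ENNReal.ofReal_ne_top
  have hvcN : volume (cellN n L) ≠ ⊤ := by
    rw [volume_cellN]; exact ENNReal.pow_ne_top (ENNReal.pow_ne_top ENNReal.ofReal_ne_top)
  -- pointwise bound of the integrand
  have hbd : ∀ (r x : Space) (Y : Config n),
      ‖‖Ψ.ψ (Matrix.vecCons (x + r) Y)‖ * ‖Ψ.ψ (Matrix.vecCons x Y)‖‖ ≤ M * M := by
    intro r x Y
    rw [Real.norm_of_nonneg (by positivity)]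
    exact mul_le_mul (hM _) (hM _) (norm_nonneg _) hM0
  -- joint continuity of the inner integral in `(r, x)`
  have hinner : Continuous fun p : Space × Space => ∫ Y in cellN n L,
      ‖Ψ.ψ (Matrix.vecCons (p.2 + p.1) Y)‖ * ‖Ψ.ψ (Matrix.vecCons p.2 Y)‖ := by
    refine continuous_of_dominated (bound := fun _ => M * M) ?_ ?_ ?_ ?_
    · intro p
      have : Continuous fun Y : Config n =>
          ‖Ψ.ψ (Matrix.vecCons (p.2 + p.1) Y)‖ * ‖Ψ.ψ (Matrix.vecCons p.2 Y)‖ := by fun_prop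
      exact this.aestronglyMeasurable
    · exact fun p => Eventually.of_forall fun Y => hbd p.1 p.2 Y
    · exact integrableOn_const hvcN
    · refine Eventually.of_forall fun Y => ?_
      fun_prop
  unfold coherence
  refine continuous_of_dominated (bound := fun _ => M * M * volume.real (cellN n L)) ?_ ?_ ?_ ?_
  · intro r
    exact (hinner.comp (Continuous.prodMk_right r)).aestronglyMeasurable
  · intro r
    refine Eventually.of_forall fun x => ?_
    exact norm_setIntegral_le_of_norm_le_const hvcN.lt_top fun Y _ => hbd r x Y
  · exact integrableOn_const hvc
  · refine Eventually.of_forall fun x => ?_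
    exact hinner.comp (Continuous.prodMk_left x)

/-- **`g > 0`** for a pointwise non-vanishing state: the integrand is bounded below by the positive
constant `(inf |Ψ|)²` and the cells have positive (finite) measure. -/
theorem coherence_pos (hL : 0 < L) (Ψ : PeriodicTrialState (n + 1) L) (hpos : ∀ X, Ψ.ψ X ≠ 0)
    (r : Space) : 0 < coherence n L Ψ r := by
  obtain ⟨M, hM⟩ := Ψ.exists_norm_le hL
  have hM0 : 0 ≤ M := (norm_nonneg _).trans (hM 0)
  obtain ⟨m, hm, hmle⟩ := exists_pos_forall_le_norm hL Ψ hpos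
  have hL0 : ENNReal.ofReal L ≠ 0 := (ENNReal.ofReal_pos.mpr hL).ne'
  have hvc : volume (cell L) ≠ 0 := by rw [volume_cell]; exact pow_ne_zero _ hL0
  have hvcN : volume (cellN n L) ≠ 0 := by
    rw [volume_cellN]; exact pow_ne_zero _ (pow_ne_zero _ hL0)
  have hvc' : volume (cell L) ≠ ⊤ := by
    rw [volume_cell]; exact ENNReal.pow_ne_top ENNReal.ofReal_ne_top
  have hvcN' : volume (cellN n L) ≠ ⊤ := by
    rw [volume_cellN]; exact ENNReal.pow_ne_top (ENNReal.pow_ne_top ENNReal.ofReal_ne_top)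
  rw [coherence_eq_toReal hL]
  refine ENNReal.toReal_pos (ne_of_gt ?_) (ne_of_lt ?_)
  · calc (0 : ℝ≥0∞) < ENNReal.ofReal (m * m) * volume (cellN n L) * volume (cell L) :=
          pos_iff_ne_zero.mpr (mul_ne_zero (mul_ne_zero (ENNReal.ofReal_pos.mpr (mul_pos hm hm)).ne'
            hvcN) hvc)
      _ = ∫⁻ _x in cell L, ∫⁻ _Y in cellN n L, ENNReal.ofReal (m * m) := by
          rw [setLIntegral_const, setLIntegral_const]
      _ ≤ _ := lintegral_mono fun x => lintegral_mono fun Y =>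
          ENNReal.ofReal_le_ofReal (mul_le_mul (hmle _) (hmle _) hm.le (norm_nonneg _))
  · calc _ ≤ ∫⁻ _x in cell L, ∫⁻ _Y in cellN n L, ENNReal.ofReal (M * M) :=
          lintegral_mono fun x => lintegral_mono fun Y =>
            ENNReal.ofReal_le_ofReal (mul_le_mul (hM _) (hM _) (norm_nonneg _) hM0)
      _ = ENNReal.ofReal (M * M) * volume (cellN n L) * volume (cell L) := by
          rw [setLIntegral_const, setLIntegral_const]
      _ < ⊤ := ENNReal.mul_lt_top (ENNReal.mul_lt_top ENNReal.ofReal_lt_top hvcN'.lt_top) hvc'.lt_top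

/-- **`g` is even**, `g(-r) = g(r)`: substitute `x ↦ x + r`, i.e. shift the fundamental cell of the
`(n+1)`-torus by `(r, 0, …, 0)` (`lintegral_cellN_comp_add`, after splitting particle `0` off by
`setLIntegral_cellN_succ_left`), then commute the two factors. -/
theorem coherence_neg (hL : 0 < L) (Ψ : PeriodicTrialState (n + 1) L) (r : Space) :
    coherence n L Ψ (-r) = coherence n L Ψ r := by
  rw [coherence_eq_toReal hL, coherence_eq_toReal hL]
  congr 1
  have hc : Continuous Ψ.ψ := Ψ.contDiff.continuous
  set C : Config (n + 1) := Matrix.vecCons r 0 with hC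
  -- the `g(r)` integrand as a periodic function on `(ℝ³)^{n+1}`
  have hGm : Measurable fun X : Config (n + 1) => ENNReal.ofReal (‖Ψ.ψ (X + C)‖ * ‖Ψ.ψ X‖) := by
    have : Continuous fun X : Config (n + 1) => ‖Ψ.ψ (X + C)‖ * ‖Ψ.ψ X‖ := by fun_prop
    exact ENNReal.measurable_ofReal.comp this.measurable
  have hGper : ∀ (X : Config (n + 1)) (i : Fin (n + 1)) (k : Fin 3),
      ENNReal.ofReal (‖Ψ.ψ (X + Pi.single i (EuclideanSpace.single k L) + C)‖ *
        ‖Ψ.ψ (X + Pi.single i (EuclideanSpace.single k L))‖) =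
        ENNReal.ofReal (‖Ψ.ψ (X + C)‖ * ‖Ψ.ψ X‖) := by
    intro X i k
    rw [add_right_comm, Ψ.periodic, Ψ.periodic]
  -- the shifted integrand
  have hGm' : Measurable fun X : Config (n + 1) =>
      ENNReal.ofReal (‖Ψ.ψ (X + -C + C)‖ * ‖Ψ.ψ (X + -C)‖) := by
    have : Continuous fun X : Config (n + 1) => ‖Ψ.ψ (X + -C + C)‖ * ‖Ψ.ψ (X + -C)‖ := by fun_prop
    exact ENNReal.measurable_ofReal.comp this.measurable
  have hshift := lintegral_cellN_comp_add hL
    (G := fun X => ENNReal.ofReal (‖Ψ.ψ (X + C)‖ * ‖Ψ.ψ X‖)) hGper (-C)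
  have h1 := setLIntegral_cellN_succ_left (L := L) hGm'
  have h2 := setLIntegral_cellN_succ_left (L := L) hGm
  have hcons1 : ∀ (x : Space) (Y : Config n), Matrix.vecCons x Y + C = Matrix.vecCons (x + r) Y := by
    intro x Y; rw [hC, Matrix.cons_add_cons, add_zero]
  have hcons2 : ∀ (x : Space) (Y : Config n),
      Matrix.vecCons x Y + -C = Matrix.vecCons (x + -r) Y := by
    intro x Y; rw [hC, Matrix.neg_cons, neg_zero, Matrix.cons_add_cons, add_zero]
  simp only [neg_add_cancel_right, hcons1, hcons2] at h1
  simp only [hcons1] at h2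
  simp only [neg_add_cancel_right] at hshift
  rw [← h2, ← hshift, h1]
  refine lintegral_congr fun x => lintegral_congr fun Y => ?_
  rw [mul_comm]

/-- `(x + (r + L e_k), Y) = (x + r, Y) + L e_{0,k}` in `(ℝ³)^{n+1}`. -/
theorem vecCons_add_add_single (x r : Space) (Y : Config n) (k : Fin 3) (L : ℝ) :
    Matrix.vecCons (x + (r + EuclideanSpace.single k L)) Y =
      Matrix.vecCons (x + r) Y + Pi.single (0 : Fin (n + 1)) (EuclideanSpace.single k L) := by
  funext i
  refine Fin.cases ?_ (fun j => ?_) i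
  · simp [add_assoc]
  · simp [Fin.succ_ne_zero]

/-- **`g` is `Lℤ³`-periodic**: `g(r + L e_k) = g(r)`, pointwise from the periodicity of `Ψ` in
particle `0`. -/
theorem coherence_add_single (Ψ : PeriodicTrialState (n + 1) L) (r : Space) (k : Fin 3) :
    coherence n L Ψ (r + EuclideanSpace.single k L) = coherence n L Ψ r := by
  unfold coherence
  simp_rw [vecCons_add_add_single, Ψ.periodic]

/-! ## The registered stub -/

/-- **Registered stub `stub_coherenceRegular` (lead reshape r1), closed**: for a pointwise
non-vanishing periodic `C¹` state of `n + 1` bosons on the torus of side `L > 0`, the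
translation-averaged coherence `g(r) = ∫_cell dx ∫_{cell^n} dY |Ψ(x+r,Y)| |Ψ(x,Y)|` is continuous,
strictly positive, `≤ 1`, `= 1` at `r = 0`, even and `Lℤ³`-periodic. -/
theorem stub_coherenceRegular :
    ∀ (n : ℕ) (L : ℝ), 0 < L → ∀ Ψ : PeriodicTrialState (n + 1) L, (∀ X, Ψ.ψ X ≠ 0) →
      Continuous (fun r : Space => ∫ x in cell L, ∫ Y in cellN n L,
          ‖Ψ.ψ (Matrix.vecCons (x + r) Y)‖ * ‖Ψ.ψ (Matrix.vecCons x Y)‖) ∧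
      (∀ r : Space, 0 < ∫ x in cell L, ∫ Y in cellN n L,
          ‖Ψ.ψ (Matrix.vecCons (x + r) Y)‖ * ‖Ψ.ψ (Matrix.vecCons x Y)‖) ∧
      (∀ r : Space, (∫ x in cell L, ∫ Y in cellN n L,
          ‖Ψ.ψ (Matrix.vecCons (x + r) Y)‖ * ‖Ψ.ψ (Matrix.vecCons x Y)‖) ≤ 1) ∧
      (∫ x in cell L, ∫ Y in cellN n L,
          ‖Ψ.ψ (Matrix.vecCons (x + 0) Y)‖ * ‖Ψ.ψ (Matrix.vecCons x Y)‖) = 1 ∧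
      (∀ r : Space, (∫ x in cell L, ∫ Y in cellN n L,
          ‖Ψ.ψ (Matrix.vecCons (x + -r) Y)‖ * ‖Ψ.ψ (Matrix.vecCons x Y)‖) =
        ∫ x in cell L, ∫ Y in cellN n L,
          ‖Ψ.ψ (Matrix.vecCons (x + r) Y)‖ * ‖Ψ.ψ (Matrix.vecCons x Y)‖) ∧
      (∀ (r : Space) (k : Fin 3), (∫ x in cell L, ∫ Y in cellN n L,
          ‖Ψ.ψ (Matrix.vecCons (x + (r + EuclideanSpace.single k L)) Y)‖ * ‖Ψ.ψ (Matrix.vecCons x Y)‖) =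
        ∫ x in cell L, ∫ Y in cellN n L,
          ‖Ψ.ψ (Matrix.vecCons (x + r) Y)‖ * ‖Ψ.ψ (Matrix.vecCons x Y)‖) := by
  intro n L hL Ψ hpos
  exact ⟨continuous_coherence hL Ψ, coherence_pos hL Ψ hpos, coherence_le_one hL Ψ,
    coherence_zero hL Ψ, coherence_neg hL Ψ, coherence_add_single Ψ⟩

end Summit.AtomisticToContinuum.BoseEinsteinCondensation.Theorems.BECConjugateDomination

end
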